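import Mathlib
import Summits.KontsevichZagierPeriods.KontsevichZagierPeriods.Theorems.SoloInformedKummerZetaMoves
import Summits.KontsevichZagierPeriods.KontsevichZagierPeriods.Theorems.SoloInformedKummerInvolution
import HarnessLib
import HarnessLib.Audit

/-!
# Kummer family IV: THEOREM XXVIII(a) — the hyperbolic reciprocity law for `Π(n|m)` in `P` (s41)

Fourth and last file of THEOREM XXVIII(a) of the residency paper (§6quattuordecies; files I–III =
`SoloInformedKummerZetaKernel`, `…Band`, `…Moves`).  For a real algebraic squared modulus
`0 < m < 1` and a real algebraic amplitude `0 < σ < 1` put `n = mσ²` (so `0 < n < m`: the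
HYPERBOLIC band of pole parameters of the Kummer family), `κ = ((1−x²)(1−mx²))^{-1/2}`,
`e = (1−mx²)κ`, and let

  `Π_n = [(0,1), κ/(1−nx²)]`, `K = [(0,1), κ]`, `E = [(0,1), e]`, `F♯ = [(0,σ), κ]`, `E♯ = [(0,σ), e]`

(complete integrals of the third, first and second kind; incomplete integrals of the first and
second kind at amplitude `sin φ = σ`).  THEOREM (`soloInformed_kummer_reciprocity`): in the formal
period ring `P` of the Kontsevich–Zagier calculus

  `⟦[pt, √((1−σ²)(1−mσ²))/σ]⟧ · (⟦Π_n⟧ − ⟦K⟧) = ⟦K⟧·⟦E♯⟧ − ⟦E⟧·⟦F♯⟧`,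

the `π`-FREE real form of the reciprocity law between the differentials of the third and of the
first/second kind (in values: Abramowitz–Stegun 17.7.6,
`Π(n|m) = K + (σ/√((1−σ²)(1−mσ²)))·(K·E(φ|m) − E·F(φ|m))`, `n = m sin²φ`).  PROOF, entirely inside
the calculus and using only the three Kontsevich–Zagier rules: subtract the kill from the
deformation of file III — both live on `(0,1)×(0,σ)` —, insert the certificate
`R(x,t)κ(x)κ(t) − R(t,x)κ(t)κ(x) = κ(x)e(t) − e(x)κ(t)` of file I (rule 1b), recognise the two
Fubini products `K × E♯`, `E × F♯` (rule 1b on product representations), and identify the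
deformed end `[(0,1), Φ(x,σ)]` with `(√W(σ)/σ)·(Π_n − K)` (`Φ(x,σ) = σ⁻¹W(σ)κ(σ)·(κ/(1−nx²) − κ)`,
file I).  Corollaries: the law in values, and the existence of the five representations.

References: M. Abramowitz, I. Stegun, *Handbook of Mathematical Functions*, 17.7.6;
M. Kontsevich, D. Zagier, *Periods* (2001), §1.2; this work (solo-informed s38, s41).
-/

noncomputable section

open MeasureTheory Set Filter
open scoped Classical

open Literature.NumberTheory.Transcendental Literature.NumberTheory.Transcendental.KZ
open Literature.ModelTheory.ExponentialFields

namespace Summit.KontsevichZagierPeriods.KontsevichZagierPeriods.Theorems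

/-! ### The scalar `√W(σ)/σ` -/

/-- `√((1−σ²)(1−mσ²))/σ` is algebraic for algebraic `m, σ ∈ (0,1)`. [folklore] -/
theorem soloInformed_kummerZeta_scalar_isAlgebraic {m σ : ℝ} (hm : m ∈ Ioo (0:ℝ) 1)
    (hma : IsAlgebraic ℚ m) (hσ : σ ∈ Ioo (0:ℝ) 1) (hσa : IsAlgebraic ℚ σ) :
    IsAlgebraic ℚ (√((1 - σ ^ 2) * (1 - m * σ ^ 2)) / σ) := by
  obtain ⟨h1, h2⟩ := soloInformed_kummerZeta_radicands_pos hm (b := σ) (by nlinarith [hσ.1, hσ.2])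
  have hWa : IsAlgebraic ℚ ((1 - σ ^ 2) * (1 - m * σ ^ 2)) :=
    (isAlgebraic_one.sub (hσa.pow 2)).mul (isAlgebraic_one.sub (hma.mul (hσa.pow 2)))
  have hr : IsAlgebraic ℚ (√((1 - σ ^ 2) * (1 - m * σ ^ 2))) :=
    IsAlgebraic.of_pow two_pos (by rw [Real.sq_sqrt (mul_pos h1 h2).le]; exact hWa)
  rw [div_eq_mul_inv]
  exact hr.mul hσa.inv

/-- `σ⁻¹ W(σ) κ(σ) = √W(σ)/σ`. [folklore] -/
theorem soloInformed_kummerZeta_scalar_eq {m σ : ℝ} (hm : m ∈ Ioo (0:ℝ) 1) (hσ : σ ∈ Ioo (0:ℝ) 1) :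
    σ⁻¹ * ((1 - σ ^ 2) * (1 - m * σ ^ 2)) * ((√(1 - σ ^ 2))⁻¹ * (√(1 - m * σ ^ 2))⁻¹) =
      √((1 - σ ^ 2) * (1 - m * σ ^ 2)) / σ := by
  obtain ⟨h1, h2⟩ := soloInformed_kummerZeta_radicands_pos hm (b := σ) (by nlinarith [hσ.1, hσ.2])
  have e1 : (1 - σ ^ 2) * (√(1 - σ ^ 2))⁻¹ = √(1 - σ ^ 2) := by
    rw [← div_eq_mul_inv, Real.div_sqrt]
  have e2 : (1 - m * σ ^ 2) * (√(1 - m * σ ^ 2))⁻¹ = √(1 - m * σ ^ 2) := by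
    rw [← div_eq_mul_inv, Real.div_sqrt]
  calc σ⁻¹ * ((1 - σ ^ 2) * (1 - m * σ ^ 2)) * ((√(1 - σ ^ 2))⁻¹ * (√(1 - m * σ ^ 2))⁻¹)
      = ((1 - σ ^ 2) * (√(1 - σ ^ 2))⁻¹) * ((1 - m * σ ^ 2) * (√(1 - m * σ ^ 2))⁻¹) / σ := by
        ring
    _ = √((1 - σ ^ 2) * (1 - m * σ ^ 2)) / σ := by rw [e1, e2, Real.sqrt_mul h1.le]

/-! ### Products of two one-dimensional interval representations -/

/-- For one-dimensional `r = [A, f]`, `s = [B, g]` (domains read through `x 0`) the product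
representation is `[A × B, f(z₀) g(z₁)]`. [cite: KontsevichZagier2001, §1.2] [this work] -/
theorem soloInformed_prod_interval (r s : IntegralRep 1) (A B : Set ℝ) (f g : ℝ → ℝ)
    (hrd : r.domain = {x : Fin 1 → ℝ | x 0 ∈ A}) (hsd : s.domain = {x : Fin 1 → ℝ | x 0 ∈ B})
    (hri : ∀ x ∈ r.domain, r.integrand x = f (x 0))
    (hsi : ∀ x ∈ s.domain, s.integrand x = g (x 0)) :
    (r.prod s).domain = {z : Fin 2 → ℝ | z 0 ∈ A ∧ z 1 ∈ B} ∧
    ∀ z : Fin 2 → ℝ, z 0 ∈ A ∧ z 1 ∈ B → (r.prod s).integrand z = f (z 0) * g (z 1) := by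
  have hc0 : Fin.castAdd 1 (0 : Fin 1) = (0 : Fin 2) := by decide
  have hn0 : Fin.natAdd 1 (0 : Fin 1) = (1 : Fin 2) := by decide
  constructor
  · rw [IntegralRep.prod_domain]
    ext z
    simp only [IntegralRep.mem_prodDomain, hrd, hsd, mem_setOf_eq, hc0, hn0]
  · intro z hz
    have h1 : (fun i : Fin 1 => z (Fin.castAdd 1 i)) ∈ r.domain := by
      rw [hrd]; show z (Fin.castAdd 1 (0 : Fin 1)) ∈ A; rw [hc0]; exact hz.1
    have h2 : (fun j : Fin 1 => z (Fin.natAdd 1 j)) ∈ s.domain := by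
      rw [hsd]; show z (Fin.natAdd 1 (0 : Fin 1)) ∈ B; rw [hn0]; exact hz.2
    rw [IntegralRep.prod_integrand_eq, IntegralRep.prodFun_apply, hri _ h1, hsi _ h2]
    show f (z (Fin.castAdd 1 (0 : Fin 1))) * g (z (Fin.natAdd 1 (0 : Fin 1))) = f (z 0) * g (z 1)
    rw [hc0, hn0]

/-! ### THEOREM XXVIII(a) -/

/-- **THEOREM XXVIII(a) (hyperbolic reciprocity law for the third kind).**  For real algebraic
`m, σ ∈ (0,1)`, `n = mσ²`, with `Π_n = [(0,1), κ/(1−nx²)]`, `K = [(0,1), κ]`, `E = [(0,1), e]`,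
`F♯ = [(0,σ), κ]`, `E♯ = [(0,σ), e]` (`κ = ((1−x²)(1−mx²))^{-1/2}`, `e = (1−mx²)κ`):
`⟦[pt, √((1−σ²)(1−mσ²))/σ]⟧·(⟦Π_n⟧ − ⟦K⟧) = ⟦K⟧⟦E♯⟧ − ⟦E⟧⟦F♯⟧` in `P` — Abramowitz–Stegun 17.7.6
inside the Kontsevich–Zagier calculus. [this work] -/
theorem soloInformed_kummer_reciprocity (m σ : ℝ) (hm : m ∈ Ioo (0:ℝ) 1) (hma : IsAlgebraic ℚ m)
    (hσ : σ ∈ Ioo (0:ℝ) 1) (hσa : IsAlgebraic ℚ σ) (PN K E Fs Es : IntegralRep 1)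
    (hPNd : PN.domain = {x | x 0 ∈ Ioo (0:ℝ) 1})
    (hPNi : EqOn PN.integrand (fun x => (1 - m * σ ^ 2 * x 0 ^ 2)⁻¹ *
      ((√(1 - x 0 ^ 2))⁻¹ * (√(1 - m * x 0 ^ 2))⁻¹)) PN.domain)
    (hKd : K.domain = {x | x 0 ∈ Ioo (0:ℝ) 1})
    (hKi : EqOn K.integrand (fun x => (√(1 - x 0 ^ 2))⁻¹ * (√(1 - m * x 0 ^ 2))⁻¹) K.domain)
    (hEd : E.domain = {x | x 0 ∈ Ioo (0:ℝ) 1})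
    (hEi : EqOn E.integrand (fun x => (1 - m * x 0 ^ 2) *
      ((√(1 - x 0 ^ 2))⁻¹ * (√(1 - m * x 0 ^ 2))⁻¹)) E.domain)
    (hFsd : Fs.domain = {x | x 0 ∈ Ioo (0:ℝ) σ})
    (hFsi : EqOn Fs.integrand (fun x => (√(1 - x 0 ^ 2))⁻¹ * (√(1 - m * x 0 ^ 2))⁻¹) Fs.domain)
    (hEsd : Es.domain = {x | x 0 ∈ Ioo (0:ℝ) σ})
    (hEsi : EqOn Es.integrand (fun x => (1 - m * x 0 ^ 2) *
      ((√(1 - x 0 ^ 2))⁻¹ * (√(1 - m * x 0 ^ 2))⁻¹)) Es.domain) :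
    toFormalPeriod (of (IntegralRep.unit.constMul (√((1 - σ ^ 2) * (1 - m * σ ^ 2)) / σ)
        (soloInformed_kummerZeta_scalar_isAlgebraic hm hma hσ hσa))) *
        (toFormalPeriod (of PN) - toFormalPeriod (of K)) =
      toFormalPeriod (of K) * toFormalPeriod (of Es) -
        toFormalPeriod (of E) * toFormalPeriod (of Fs) := by
  have hc := soloInformed_kummerZeta_scalar_isAlgebraic hm hma hσ hσa
  -- the two moves
  obtain ⟨r', rd, hr'd, hr'i, hrdd, hrdi, hdef⟩ :=
    soloInformed_kummerZeta_deformation m σ hm hma hσ hσa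
  obtain ⟨T, hTd, hTi, hT⟩ := soloInformed_kummerZeta_killed m σ hm hma hσ hσa
  -- Fubini: the two products
  obtain ⟨hP2d, hP2i⟩ := soloInformed_prod_interval K Es (Ioo (0:ℝ) 1) (Ioo (0:ℝ) σ)
    (fun u => (√(1 - u ^ 2))⁻¹ * (√(1 - m * u ^ 2))⁻¹)
    (fun u => (1 - m * u ^ 2) * ((√(1 - u ^ 2))⁻¹ * (√(1 - m * u ^ 2))⁻¹)) hKd hEsd
    (fun x hx => hKi hx) (fun x hx => hEsi hx)
  obtain ⟨hP3d, hP3i⟩ := soloInformed_prod_interval E Fs (Ioo (0:ℝ) 1) (Ioo (0:ℝ) σ)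
    (fun u => (1 - m * u ^ 2) * ((√(1 - u ^ 2))⁻¹ * (√(1 - m * u ^ 2))⁻¹))
    (fun u => (√(1 - u ^ 2))⁻¹ * (√(1 - m * u ^ 2))⁻¹) hEd hFsd
    (fun x hx => hEi hx) (fun x hx => hFsi hx)
  -- the difference of the two products as one representation on `(0,1)×(0,σ)`
  have hO := r'.isSemialgebraic_domain
  rw [hr'd] at hO
  have h2sa := (K.prod Es).isSemialgebraicFunOn_integrand
  have h3sa := (E.prod Fs).isSemialgebraicFunOn_integrand
  have h2i := (K.prod Es).integrableOn
  have h3i := (E.prod Fs).integrableOn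
  rw [hP2d] at h2sa h2i
  rw [hP3d] at h3sa h3i
  set Q : IntegralRep 2 := ⟨{z : Fin 2 → ℝ | z 0 ∈ Ioo (0:ℝ) 1 ∧ z 1 ∈ Ioo (0:ℝ) σ},
    fun z => (K.prod Es).integrand z - (E.prod Fs).integrand z, hO,
    (h2sa.sub_holds h3sa).congr fun z _ => by simp only [Pi.sub_apply], h2i.sub h3i⟩ with hQ
  -- rule 1b with the certificate: `r' = T + Q` as integrands
  have hrel1 : of r' - of T - of Q ∈ relations := by
    refine integrandAddRel_subset_relations ⟨2, r', T, Q, by rw [hTd, hr'd], by rw [hr'd],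
      fun z hz => ?_, rfl⟩
    rw [hr'd] at hz
    have hz' : z 0 ∈ Ioo (0:ℝ) 1 ∧ z 1 ∈ Ioo (0:ℝ) σ := hz
    have hD : 1 - m * z 0 ^ 2 * z 1 ^ 2 ≠ 0 :=
      (soloInformed_kummerZeta_denom_pos hm (by nlinarith [hz'.1.1, hz'.1.2])
        (by nlinarith [hz'.2.1, hz'.2.2, hσ.2])).2.ne'
    rw [Pi.add_apply, hr'i, hTi]
    simp only [hQ, hP2i z hz', hP3i z hz']
    linear_combination soloInformed_kummerZeta_certificate hD
  have hrel2 : of (K.prod Es) - of Q - of (E.prod Fs) ∈ relations := by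
    refine integrandAddRel_subset_relations ⟨2, K.prod Es, Q, E.prod Fs, by rw [hP2d],
      by rw [hP3d, hP2d], fun z _ => ?_, rfl⟩
    simp only [Pi.add_apply, hQ]
    ring
  -- the deformed end `[(0,1), Φ(x,σ)]` is `(√W/σ)·(Π_n − K)`
  have hB : IsSemialgebraic ℚ {x : Fin 1 → ℝ | x 0 ∈ Ioo (0:ℝ) 1} :=
    BallPeeling.isSemialgebraic_posIoo
  have hPNsa := PN.isSemialgebraicFunOn_integrand
  have hKsa := K.isSemialgebraicFunOn_integrand
  have hPNint := PN.integrableOn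
  have hKint := K.integrableOn
  rw [hPNd] at hPNsa hPNint
  rw [hKd] at hKsa hKint
  set D₁ : IntegralRep 1 := ⟨{x : Fin 1 → ℝ | x 0 ∈ Ioo (0:ℝ) 1},
    fun x => PN.integrand x - K.integrand x, hB,
    (hPNsa.sub_holds hKsa).congr fun x _ => by simp only [Pi.sub_apply], hPNint.sub hKint⟩
    with hD₁
  have hrel3 : of PN - of K - of D₁ ∈ relations := by
    refine integrandAddRel_subset_relations ⟨1, PN, K, D₁, by rw [hKd, hPNd], by rw [hPNd],
      fun x _ => ?_, rfl⟩
    simp only [Pi.add_apply, hD₁]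
    ring
  have hσ0 : σ ≠ 0 := hσ.1.ne'
  have hrel4 : of rd - of (D₁.constMul _ hc) ∈ relations := by
    refine of_sub_of_mem_relations_of_eqOn (by rw [IntegralRep.domain_constMul, hrdd])
      fun x hx => ?_
    rw [hrdd] at hx
    have hx' : x 0 ∈ Ioo (0:ℝ) 1 := hx
    have hxPN : x ∈ PN.domain := by rw [hPNd]; exact hx
    have hxK : x ∈ K.domain := by rw [hKd]; exact hx
    have hD : 1 - m * σ ^ 2 * x 0 ^ 2 ≠ 0 :=
      (soloInformed_kummerZeta_denom_pos hm (by nlinarith [hσ.1, hσ.2])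
        (by nlinarith [hx'.1, hx'.2])).2.ne'
    simp only [hrdi, IntegralRep.integrand_constMul, hD₁, hPNi hxPN, hKi hxK]
    rw [soloInformed_kummerZetaPhi_end hσ0 hD, ← soloInformed_kummerZeta_scalar_eq hm hσ]
    ring
  -- assemble in `P`
  have h5 : of r' - of Q ∈ relations := by
    have h := relations.add_mem hrel1 hT
    have e : of r' - of Q = of r' - of T - of Q + of T := by abel
    rw [e]
    exact h
  have h6 : of (K.prod Es) - of (E.prod Fs) - of Q ∈ relations := by
    have e : of (K.prod Es) - of (E.prod Fs) - of Q =
        of (K.prod Es) - of Q - of (E.prod Fs) := by abel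
    rw [e]
    exact hrel2
  have t3 : toFormalPeriod (of PN) - toFormalPeriod (of K) = toFormalPeriod (of D₁) := by
    rw [← map_sub]
    exact toFormalPeriod_eq_iff.mpr hrel3
  have t6 : toFormalPeriod (of (K.prod Es)) - toFormalPeriod (of (E.prod Fs)) =
      toFormalPeriod (of Q) := by
    rw [← map_sub]
    exact toFormalPeriod_eq_iff.mpr h6
  calc toFormalPeriod (of (IntegralRep.unit.constMul _ hc)) *
        (toFormalPeriod (of PN) - toFormalPeriod (of K))
      = toFormalPeriod (of (IntegralRep.unit.constMul _ hc)) * toFormalPeriod (of D₁) := by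
        rw [t3]
    _ = toFormalPeriod (of (D₁.constMul _ hc)) := (toFormalPeriod_of_constMul _ hc D₁).symm
    _ = toFormalPeriod (of rd) := (toFormalPeriod_eq_iff.mpr hrel4).symm
    _ = toFormalPeriod (of r') := (toFormalPeriod_eq_iff.mpr hdef).symm
    _ = toFormalPeriod (of Q) := toFormalPeriod_eq_iff.mpr h5
    _ = toFormalPeriod (of (K.prod Es)) - toFormalPeriod (of (E.prod Fs)) := t6.symm
    _ = toFormalPeriod (of K) * toFormalPeriod (of Es) -
          toFormalPeriod (of E) * toFormalPeriod (of Fs) := by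
        rw [toFormalPeriod_of_mul_of, toFormalPeriod_of_mul_of]

/-- **THEOREM XXVIII(a) in values** (Abramowitz–Stegun 17.7.6, `0 < n < m`):
`(√((1−σ²)(1−mσ²))/σ)·(Π(mσ²|m) − K(m)) = K(m)E(φ|m) − E(m)F(φ|m)`, `sin φ = σ`. [this work] -/
theorem soloInformed_kummer_reciprocity_value (m σ : ℝ) (hm : m ∈ Ioo (0:ℝ) 1)
    (hma : IsAlgebraic ℚ m) (hσ : σ ∈ Ioo (0:ℝ) 1) (hσa : IsAlgebraic ℚ σ)
    (PN K E Fs Es : IntegralRep 1)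
    (hPNd : PN.domain = {x | x 0 ∈ Ioo (0:ℝ) 1})
    (hPNi : EqOn PN.integrand (fun x => (1 - m * σ ^ 2 * x 0 ^ 2)⁻¹ *
      ((√(1 - x 0 ^ 2))⁻¹ * (√(1 - m * x 0 ^ 2))⁻¹)) PN.domain)
    (hKd : K.domain = {x | x 0 ∈ Ioo (0:ℝ) 1})
    (hKi : EqOn K.integrand (fun x => (√(1 - x 0 ^ 2))⁻¹ * (√(1 - m * x 0 ^ 2))⁻¹) K.domain)
    (hEd : E.domain = {x | x 0 ∈ Ioo (0:ℝ) 1})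
    (hEi : EqOn E.integrand (fun x => (1 - m * x 0 ^ 2) *
      ((√(1 - x 0 ^ 2))⁻¹ * (√(1 - m * x 0 ^ 2))⁻¹)) E.domain)
    (hFsd : Fs.domain = {x | x 0 ∈ Ioo (0:ℝ) σ})
    (hFsi : EqOn Fs.integrand (fun x => (√(1 - x 0 ^ 2))⁻¹ * (√(1 - m * x 0 ^ 2))⁻¹) Fs.domain)
    (hEsd : Es.domain = {x | x 0 ∈ Ioo (0:ℝ) σ})
    (hEsi : EqOn Es.integrand (fun x => (1 - m * x 0 ^ 2) *
      ((√(1 - x 0 ^ 2))⁻¹ * (√(1 - m * x 0 ^ 2))⁻¹)) Es.domain) :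
    √((1 - σ ^ 2) * (1 - m * σ ^ 2)) / σ * (PN.value - K.value) =
      K.value * Es.value - E.value * Fs.value := by
  have h := congrArg evalP (soloInformed_kummer_reciprocity m σ hm hma hσ hσa PN K E Fs Es hPNd
    hPNi hKd hKi hEd hEi hFsd hFsi hEsd hEsi)
  simpa only [map_mul, map_sub, evalP_toFormalPeriod_of, IntegralRep.value_constMul,
    IntegralRep.value_unit, mul_one] using h

/-- **The five representations exist**, and satisfy the law. [this work] -/
theorem soloInformed_kummer_reciprocity_exists (m σ : ℝ) (hm : m ∈ Ioo (0:ℝ) 1)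
    (hma : IsAlgebraic ℚ m) (hσ : σ ∈ Ioo (0:ℝ) 1) (hσa : IsAlgebraic ℚ σ) :
    ∃ PN K E Fs Es : IntegralRep 1,
      PN.domain = {x | x 0 ∈ Ioo (0:ℝ) 1} ∧
      (∀ x, PN.integrand x = (1 - m * σ ^ 2 * x 0 ^ 2)⁻¹ *
        ((√(1 - x 0 ^ 2))⁻¹ * (√(1 - m * x 0 ^ 2))⁻¹)) ∧
      K.domain = {x | x 0 ∈ Ioo (0:ℝ) 1} ∧
      (∀ x, K.integrand x = (√(1 - x 0 ^ 2))⁻¹ * (√(1 - m * x 0 ^ 2))⁻¹) ∧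
      E.domain = {x | x 0 ∈ Ioo (0:ℝ) 1} ∧
      (∀ x, E.integrand x = (1 - m * x 0 ^ 2) * ((√(1 - x 0 ^ 2))⁻¹ * (√(1 - m * x 0 ^ 2))⁻¹)) ∧
      Fs.domain = {x | x 0 ∈ Ioo (0:ℝ) σ} ∧
      (∀ x, Fs.integrand x = (√(1 - x 0 ^ 2))⁻¹ * (√(1 - m * x 0 ^ 2))⁻¹) ∧
      Es.domain = {x | x 0 ∈ Ioo (0:ℝ) σ} ∧
      (∀ x, Es.integrand x = (1 - m * x 0 ^ 2) * ((√(1 - x 0 ^ 2))⁻¹ * (√(1 - m * x 0 ^ 2))⁻¹)) ∧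
      √((1 - σ ^ 2) * (1 - m * σ ^ 2)) / σ * (PN.value - K.value) =
        K.value * Es.value - E.value * Fs.value := by
  have hn : m * σ ^ 2 < 1 := by nlinarith [hm.1, hm.2, hσ.1, hσ.2]
  obtain ⟨PN, hPNd, hPNi⟩ := soloInformed_exists_ellipticPi_rep_of_lt_one (m * σ ^ 2) m hn
    (hma.mul (hσa.pow 2)) hm hma
  obtain ⟨K, hKd, hKi⟩ := soloInformed_exists_ellipticK_rep m hm hma
  obtain ⟨E, hEd, hEi⟩ := soloInformed_exists_ellipticE_rep m hm hma
  have hI : IsSemialgebraic ℚ {x : Fin 1 → ℝ | x 0 ∈ Ioo (0:ℝ) σ} :=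
    (isSemialgebraic_setOf_const_lt_apply isAlgebraic_zero 0).inter
      (isSemialgebraic_setOf_apply_lt_const hσa 0)
  have hIK : {x : Fin 1 → ℝ | x 0 ∈ Ioo (0:ℝ) σ} ⊆ K.domain := fun x hx => by
    rw [hKd]; exact ⟨hx.1, hx.2.trans hσ.2⟩
  have hIE : {x : Fin 1 → ℝ | x 0 ∈ Ioo (0:ℝ) σ} ⊆ E.domain := fun x hx => by
    rw [hEd]; exact ⟨hx.1, hx.2.trans hσ.2⟩
  refine ⟨PN, K, E, K.restrict _ hI hIK, E.restrict _ hI hIE, hPNd, hPNi, hKd, hKi, hEd, hEi,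
    rfl, fun x => by rw [IntegralRep.integrand_restrict, hKi], rfl,
    fun x => by rw [IntegralRep.integrand_restrict, hEi], ?_⟩
  exact soloInformed_kummer_reciprocity_value m σ hm hma hσ hσa PN K E _ _ hPNd
    (fun x _ => hPNi x) hKd (fun x _ => hKi x) hEd (fun x _ => hEi x) rfl
    (fun x _ => by rw [IntegralRep.integrand_restrict, hKi]) rfl
    (fun x _ => by rw [IntegralRep.integrand_restrict, hEi])

end Summit.KontsevichZagierPeriods.KontsevichZagierPeriods.Theorems

end
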